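import Summits.BirchSwinnertonDyer.BirchSwinnertonDyer.Theses.TangentCone
import Literature.NumberTheory.EllipticCurves.IwasawaLeadingTermProofs
import Literature.Barriers.BirchSwinnertonDyer.SelmerVersusMordellWeilProofs

/-!
# Crux `SelmerRankShaPFinite` (stmt-BirchSwinnertonDyer-0132) — STRATEGY CENSUS, kernel-checked companion

Crux-strategist unit `cstrat-stmt-BirchSwinnertonDyer-0132-b1` (route TangentCone; the item is shared
verbatim by SelmerRank / ToricShedding / FrozenTwin / VerticalContact). This file is the Lean side of
`STRATEGY-CENSUS.md`: every claim of the census that is a statement about the tree is proved here,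
sorry-free, from tree theorems only:

* §0 DICTIONARY. `Finite Ш(W)[p^∞] ↔ corank Sel_{p^∞}(W) ≤ rank W(ℚ)` (Greenberg's identity
  `selmerCorank_eq_mordellWeilRank_add_holds` + cofinite generation
  `finite_primaryComponent_sha_iff_shaCorank_eq_zero`, both tree theorems), hence the crux is
  LITERALLY "every `p^∞`-Selmer corank is realised by rational points" (`crux_iff_selmerCorank_le_rank`).
* §1 HIDDEN SUMMIT. At any prime where `corank Sel_{p^∞} = r_an` (what the route's UB/LB cruxes
  establish at the tangent-cone prime) the crux instance is EQUIVALENT to `rank = r_an` for that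
  curve (`finite_at_iff_bsd_at`); the summit plus Selmer-rank-BSD-UB at all primes gives the crux
  back (`crux_of_bsd_of_selmerUB`).
* §2 DECOMPOSITION (best typed split Σ1). `ShaPFiniteRankLeOne → PointsLB → SelmerUBAllPrimes →
  SelmerRankShaPFinite` (`crux_of_split`); the known sector follows from the route leaf `RankLeOne`.
* §3 NEGATION. The crux implies `p`-independence of the Selmer corank (`selmerCorank_indep_of_crux`);
  a counterexample is exactly a curve with two distinct coranks (`not_crux_of_corank_ne`); the
  one-prime-plus-anchor split Σ2 (`crux_of_onePrime_of_sci`).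
* §4 STRENGTHEN / TRANSFER shapes. The squeeze through any intermediate invariant (the `p`-adic
  analytic rank: Kato side + MTT "≤ rank" half) and "points first, Ш after" (Gross–Zagier–Kolyvagin
  shape) (`finite_of_squeeze`, `finite_of_points_first`).
* §5 RE-GLUE RECIPE for the tenure planner (NOT an edit of `closes`): with the rank-≥-2 point-existence
  half `PointsLB` the two shared cruxes `SelmerRankLB` and `SelmerRankShaPFinite` are OUTPUT, and
  `closes_points : EdgeDecay → EdgeCap → PointsLB → SelmerRankSmallImage → RankLeOne →
  BirchSwinnertonDyer` is certified below (same bookkeeping as the route's `closes`, Ш never used).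
-/

namespace Summit.BirchSwinnertonDyer.BirchSwinnertonDyer.Cruxes.SelmerRankShaPFinite.Census

open Summit.BirchSwinnertonDyer.BirchSwinnertonDyer.Theses.TangentCone
open WeierstrassCurve Literature.NumberTheory.EllipticCurves
open Literature.Barriers.BirchSwinnertonDyer (SelmerRankBarrierNarrow_holds)

/-! ## §0 Dictionary: the crux is "Selmer corank ≤ rank" -/

/-- Pointwise: `Ш(W)[p^∞]` finite iff `corank_{ℤ_p} Sel_{p^∞}(W/ℚ) ≤ rank W(ℚ)`
(tree: Greenberg identity + cofinite generation of `Ш[p^∞]`). -/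
theorem finite_iff_selmerCorank_le_rank (W : WeierstrassCurve ℚ) [W.IsElliptic] (p : ℕ)
    [Fact p.Prime] :
    Finite ↥(AddCommGroup.primaryComponent W.sha p) ↔ W.selmerCorank p ≤ W.mordellWeilRank := by
  rw [finite_primaryComponent_sha_iff_shaCorank_eq_zero W p]
  have h : W.selmerCorank p = W.mordellWeilRank + W.shaCorank p :=
    W.selmerCorank_eq_mordellWeilRank_add_holds p
  omega

/-- `rank ≤ corank Sel_{p^∞}` always (tree barrier `SelmerRankBarrierNarrow_holds`, conjunct 1). -/
theorem rank_le_selmerCorank (W : WeierstrassCurve ℚ) [W.IsElliptic] (p : ℕ) [Fact p.Prime] :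
    W.mordellWeilRank ≤ W.selmerCorank p :=
  (SelmerRankBarrierNarrow_holds ℚ W p).1

/-- The crux, verbatim, is equivalent to: every `p^∞`-Selmer corank of every elliptic curve over
`ℚ` is realised by rational points. -/
theorem crux_iff_selmerCorank_le_rank :
    SelmerRankShaPFinite ↔
      ∀ (W : WeierstrassCurve ℚ) [W.IsElliptic] (p : ℕ) [Fact p.Prime],
        W.selmerCorank p ≤ W.mordellWeilRank := by
  constructor
  · intro h W _ p _
    exact (finite_iff_selmerCorank_le_rank W p).1 (h W p)
  · intro h W _ p _
    exact (finite_iff_selmerCorank_le_rank W p).2 (h W p)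

/-- Equivalently: the Selmer corank EQUALS the rank everywhere. -/
theorem crux_iff_selmerCorank_eq_rank :
    SelmerRankShaPFinite ↔
      ∀ (W : WeierstrassCurve ℚ) [W.IsElliptic] (p : ℕ) [Fact p.Prime],
        W.selmerCorank p = W.mordellWeilRank := by
  rw [crux_iff_selmerCorank_le_rank]
  refine ⟨fun h W _ p _ => le_antisymm (h W p) (rank_le_selmerCorank W p),
    fun h W _ p _ => (h W p).le⟩

/-! ## §1 Hidden summit: the consumed instance decides BSD for that curve -/

/-- At a prime where Selmer-rank BSD holds (`corank Sel_{p^∞} = r_an`, which the route's cruxes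
EdgeDecay ∧ EdgeCap ∧ SelmerRankLB establish at the tangent-cone prime), the crux instance
`Finite Ш(V)[p^∞]` is EQUIVALENT to the summit statement for `V`. -/
theorem finite_at_iff_bsd_at (V : WeierstrassCurve ℚ) [V.IsElliptic] (p : ℕ) [Fact p.Prime]
    (hcor : V.selmerCorank p = V.analyticRank) :
    Finite ↥(AddCommGroup.primaryComponent V.sha p) ↔ V.mordellWeilRank = V.analyticRank := by
  rw [finite_iff_selmerCorank_le_rank]
  have h := rank_le_selmerCorank V p
  omega

/-- One direction spelled out: proving the consumed instance proves `rank V = r_an V`. -/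
theorem rank_eq_analyticRank_of_finite_at (V : WeierstrassCurve ℚ) [V.IsElliptic] (p : ℕ)
    [Fact p.Prime] (hcor : V.selmerCorank p = V.analyticRank)
    (hfin : Finite ↥(AddCommGroup.primaryComponent V.sha p)) :
    V.mordellWeilRank = V.analyticRank :=
  (finite_at_iff_bsd_at V p hcor).1 hfin

/-- Conversely the summit together with the Selmer-rank UPPER bound at EVERY prime returns the
crux (the crux demands more than the summit: content at bad, supersingular and small primes). -/
theorem crux_of_bsd_of_selmerUB (hS : _root_.BirchSwinnertonDyer)
    (hUB : ∀ (W : WeierstrassCurve ℚ) [W.IsElliptic] (p : ℕ) [Fact p.Prime],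
      W.selmerCorank p ≤ W.analyticRank) :
    SelmerRankShaPFinite := by
  intro W _ p _
  rw [finite_iff_selmerCorank_le_rank]
  have h1 : W.analyticRank = W.mordellWeilRank := hS W ‹W.IsElliptic›
  have h2 := hUB W p
  omega

/-! ## §2 Decomposition Σ1 (best typed split): known sector ∧ points ∧ Selmer UB at every prime -/

/-- Known sector (Gross–Zagier–Kolyvagin, Kato): `r_an ≤ 1 ⇒ Ш[p^∞]` finite at every `p`. -/
def ShaPFiniteRankLeOne : Prop :=
  ∀ (W : WeierstrassCurve ℚ) [W.IsElliptic], W.analyticRank ≤ 1 →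
    ∀ (p : ℕ) [Fact p.Prime], Finite ↥(AddCommGroup.primaryComponent W.sha p)

/-- The point-existence (lower-bound) half of the summit in analytic rank ≥ 2. -/
def PointsLB : Prop :=
  ∀ (W : WeierstrassCurve ℚ) [W.IsElliptic], 2 ≤ W.analyticRank → W.analyticRank ≤ W.mordellWeilRank

/-- Selmer-rank BSD, upper-bound half, at EVERY prime, in analytic rank ≥ 2. -/
def SelmerUBAllPrimes : Prop :=
  ∀ (W : WeierstrassCurve ℚ) [W.IsElliptic] (p : ℕ) [Fact p.Prime], 2 ≤ W.analyticRank →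
    W.selmerCorank p ≤ W.analyticRank

/-- The known sector is the route leaf `RankLeOne` (a finite `Ш` has finite `p`-primary parts). -/
theorem shaPFiniteRankLeOne_of_rankLeOne (h : RankLeOne) : ShaPFiniteRankLeOne := by
  intro W _ h1 p _
  haveI : Finite W.sha := (h W h1).2
  infer_instance

/-- **Σ1.** Known sector → points → Selmer UB at all primes → the crux (glue = the dictionary). -/
theorem crux_of_split (h1 : ShaPFiniteRankLeOne) (h2 : PointsLB) (h3 : SelmerUBAllPrimes) :
    SelmerRankShaPFinite := by
  intro W _ p _
  by_cases hr : W.analyticRank ≤ 1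
  · exact h1 W hr p
  · rw [finite_iff_selmerCorank_le_rank]
    have h2' := h2 W (by omega)
    have h3' := h3 W p (by omega)
    omega

/-- The two open pieces prove MORE than the crux: they also give the summit in rank ≥ 2 (so Σ1 is a
split of `crux ∧ BSD`, and `PointsLB` is the summit's open half — the piece that stays hard). -/
theorem bsd_ge_two_of_split (h2 : PointsLB) (h3 : SelmerUBAllPrimes) (W : WeierstrassCurve ℚ)
    [W.IsElliptic] (h : 2 ≤ W.analyticRank) : W.mordellWeilRank = W.analyticRank := by
  have := h2 W h
  have := h3 W 2 h
  have := rank_le_selmerCorank W 2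
  omega

/-! ## §3 Negation: the crux forces `p`-independence of the Selmer corank -/

/-- `p`-independence of the `p^∞`-Selmer corank (SCI): open; known mod 2 (Dokchitser–Dokchitser);
over function fields it is `ℓ`-independence of the Frobenius-semisimplicity defect, also open. -/
def SCI : Prop :=
  ∀ (W : WeierstrassCurve ℚ) [W.IsElliptic] (p q : ℕ) [Fact p.Prime] [Fact q.Prime],
    W.selmerCorank p = W.selmerCorank q

/-- The crux implies SCI. -/
theorem sci_of_crux (h : SelmerRankShaPFinite) : SCI := by
  intro W _ p q _ _
  have hp := (crux_iff_selmerCorank_eq_rank.1 h) W p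
  have hq := (crux_iff_selmerCorank_eq_rank.1 h) W q
  omega

/-- Hence a counterexample to the crux is exactly an elliptic curve with two different Selmer
coranks — which would need a rank UPPER bound strictly below a proved Selmer corank, i.e. a second
prime `q` with `corank Sel_{q^∞} < corank Sel_{p^∞}`. -/
theorem not_crux_of_corank_ne (W : WeierstrassCurve ℚ) [W.IsElliptic] (p q : ℕ) [Fact p.Prime]
    [Fact q.Prime] (h : W.selmerCorank p ≠ W.selmerCorank q) : ¬ SelmerRankShaPFinite :=
  fun hc => h (sci_of_crux hc W p q)

/-- One good prime per curve. -/
def OnePrime : Prop :=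
  ∀ (W : WeierstrassCurve ℚ) [W.IsElliptic],
    ∃ (p : ℕ) (_ : Fact p.Prime), Finite ↥(AddCommGroup.primaryComponent W.sha p)

/-- **Σ2.** One prime per curve plus SCI gives the crux (and the crux gives both back). -/
theorem crux_of_onePrime_of_sci (h1 : OnePrime) (h2 : SCI) : SelmerRankShaPFinite := by
  intro W _ p _
  obtain ⟨q, hq, hfin⟩ := h1 W
  rw [finite_iff_selmerCorank_le_rank] at hfin ⊢
  have := h2 W p q
  omega

theorem onePrime_of_crux (h : SelmerRankShaPFinite) : OnePrime :=
  fun W _ => ⟨2, ⟨Nat.prime_two⟩, h W 2⟩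

/-! ## §4 Strengthen / transfer shapes: every mechanism is a squeeze through the rank -/

/-- STRENGTHEN (S⁺ = the "≤ rank" half of `p`-adic BSD at one prime, route PAdicOrderV2's
`PAdicOrderPadicBSDrankR2`): any invariant `ν` (e.g. `ord_{T=0} L_p(E,T) : ℕ∞`) with the Kato-side
bound `corank Sel_{p^∞} ≤ ν` and the Mordell–Weil-side bound `ν ≤ rank` yields the crux at `p`. By
Schneider's theorem (tree fact `Schneider1985_order_charGenerator`) plus IMC, `ν = ord_T L_p ≤ rank`
is the crux at `p` AND non-degeneracy of the `p`-adic height — strictly stronger, not easier. -/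
theorem finite_of_squeeze (W : WeierstrassCurve ℚ) [W.IsElliptic] (p : ℕ) [Fact p.Prime] (ν : ℕ∞)
    (hK : (W.selmerCorank p : ℕ∞) ≤ ν) (hM : ν ≤ (W.mordellWeilRank : ℕ∞)) :
    Finite ↥(AddCommGroup.primaryComponent W.sha p) := by
  rw [finite_iff_selmerCorank_le_rank]
  exact_mod_cast hK.trans hM

/-- TRANSFER (the solved sibling `r_an ≤ 1`: points FIRST, Ш after — Gross–Zagier gives the point,
Kolyvagin the Selmer bound): `n` independent points and a Selmer bound `corank ≤ n` at ONE prime give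
`rank = n` and the crux at that prime. In rank ≥ 2 the missing input is the points. -/
theorem finite_of_points_first (W : WeierstrassCurve ℚ) [W.IsElliptic] (p : ℕ) [Fact p.Prime]
    (n : ℕ) (hn : n ≤ W.mordellWeilRank) (hs : W.selmerCorank p ≤ n) :
    W.mordellWeilRank = n ∧ Finite ↥(AddCommGroup.primaryComponent W.sha p) := by
  refine ⟨?_, (finite_iff_selmerCorank_le_rank W p).2 (hs.trans hn)⟩
  have := rank_le_selmerCorank W p
  omega

/-! ## §5 Re-glue recipe (recommendation to the tenure planner; `closes` itself is untouched) -/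

/-- With the point half `PointsLB`, the shared crux `SelmerRankLB` is OUTPUT (given the leaf
`RankLeOne` for `r_an ≤ 1`): `r_an ≤ rank ≤ corank Sel_{p^∞}` at every prime. -/
theorem selmerRankLB_of_points (hP : PointsLB) (hR1 : RankLeOne) : SelmerRankLB := by
  intro W _ _ p _ _ _ _ _
  have h0 := rank_le_selmerCorank W p
  by_cases hr : W.analyticRank ≤ 1
  · have := (hR1 W hr).1
    omega
  · have := hP W (by omega)
    omega

/-- With the point half, at any prime carrying a Selmer UB the crux instance AND `rank = r_an` are
OUTPUT together (the barrier audit's "points first, Ш after"). -/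
theorem lb_sha_bsd_of_points (hP : PointsLB) (V : WeierstrassCurve ℚ) [V.IsElliptic] (p : ℕ)
    [Fact p.Prime] (h2 : 2 ≤ V.analyticRank) (hUB : V.selmerCorank p ≤ V.analyticRank) :
    V.analyticRank ≤ V.selmerCorank p ∧ Finite ↥(AddCommGroup.primaryComponent V.sha p) ∧
      V.mordellWeilRank = V.analyticRank := by
  have h0 := rank_le_selmerCorank V p
  have h1 := hP V h2
  refine ⟨by omega, (finite_iff_selmerCorank_le_rank V p).2 (by omega), by omega⟩

/-- **Certified alternative deciding theorem** (same bookkeeping as the route's `closes`, with the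
two shared cruxes `SelmerRankLB`, `SelmerRankShaPFinite` replaced by the single point-existence
statement `PointsLB`; Ш-finiteness is never used — it is a corollary at the cone prime). -/
theorem closes_points (hE : EdgeDecay) (hC : EdgeCap) (hP : PointsLB)
    (hSI : SelmerRankSmallImage) (hR1 : RankLeOne) : _root_.BirchSwinnertonDyer := by
  -- (T1) the Mordell–Weil rank is an isomorphism invariant
  have hMW : ∀ (W : WeierstrassCurve ℚ) (C : WeierstrassCurve.VariableChange ℚ),
      (C • W).mordellWeilRank = W.mordellWeilRank := fun W C =>
    @WeierstrassCurve.VariableChange.finrank_point_variableChange ℚ _ W C (Classical.decEq ℚ)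
  -- (T2) the local Euler factor is an isomorphism invariant
  have hloc : ∀ (R : Type) [CommRing R] [IsDomain R] [IsDiscreteValuationRing R]
      (K : Type) [Field K] [Algebra R K] [IsFractionRing R K]
      (W : WeierstrassCurve K) [W.IsElliptic] (C : WeierstrassCurve.VariableChange K),
      (C • W).localEulerFactor R = W.localEulerFactor R := by
    intro R _ _ _ K _ _ _ W _ C
    obtain ⟨D, hD⟩ : ∃ D : WeierstrassCurve.VariableChange K,
        (C • W).minimal R = D • W.minimal R :=
      ⟨((C • W).exists_isMinimal R).choose * C * ((W.exists_isMinimal R).choose)⁻¹, by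
        rw [WeierstrassCurve.minimal, WeierstrassCurve.minimal, mul_smul, mul_smul, inv_smul_smul]⟩
    haveI hE' : (W.minimal R).IsElliptic := by rw [WeierstrassCurve.minimal]; infer_instance
    have hΔ : (W.minimal R).Δ ≠ 0 := (W.minimal R).isUnit_Δ.ne_zero
    have hgood : ((C • W).minimal R).HasGoodReduction R ↔ (W.minimal R).HasGoodReduction R := by
      rw [WeierstrassCurve.hasGoodReduction_iff, WeierstrassCurve.hasGoodReduction_iff,
        WeierstrassCurve.valuation_Δ_eq_of_isMinimal_of_eq_smul R hD]
      exact and_congr_left' ⟨fun _ => inferInstance, fun _ => inferInstance⟩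
    have hcard : Nat.card (((C • W).minimal R).reduction R).toAffine.Point =
        Nat.card ((W.minimal R).reduction R).toAffine.Point := by
      obtain ⟨E, hE⟩ := WeierstrassCurve.exists_reduction_eq_smul R hD hΔ
      rw [hE]
      exact WeierstrassCurve.natCard_point_smul _ _
    have hpoly : (C • W).localPolynomial R = W.localPolynomial R := by
      classical
      unfold WeierstrassCurve.localPolynomial
      simp only [hgood, hcard,
        WeierstrassCurve.hasSplitMultiplicativeReduction_iff_of_isMinimal_of_eq_smul R hD hΔ,
        WeierstrassCurve.hasMultiplicativeReduction_iff_of_isMinimal_of_eq_smul R hD hΔ]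
    simp only [WeierstrassCurve.localEulerFactor, WeierstrassCurve.localPowerSeries, hpoly]
  -- (T3) hence the analytic rank is an isomorphism invariant
  have hAn : ∀ (W : WeierstrassCurve ℚ) [W.IsElliptic] (C : WeierstrassCurve.VariableChange ℚ),
      (C • W).analyticRank = W.analyticRank := by
    intro W _ C
    have hL : (C • W).LFunction = W.LFunction := by
      unfold WeierstrassCurve.LFunction
      congr 1
      funext v
      simp only [WeierstrassCurve.baseChange, ← WeierstrassCurve.map_variableChange]
      exact hloc _ _ _ _
    have hLS : (C • W).LSeries = W.LSeries := by
      funext s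
      simp only [WeierstrassCurve.LSeries, hL]
    have hEC : (C • W).entireContinuations = W.entireContinuations := by
      simp only [WeierstrassCurve.entireContinuations, hLS]
    have hEL : (C • W).entireLFunction = W.entireLFunction := by
      unfold WeierstrassCurve.entireLFunction
      rw [hEC, hLS]
    simp only [WeierstrassCurve.analyticRank, hEL]
  -- Selmer-rank UPPER bound at ONE prime on a global minimal model of analytic rank ≥ 2
  have hsel : ∀ (V : WeierstrassCurve ℚ) [V.IsElliptic] [V.IsGloballyMinimal], 2 ≤ V.analyticRank →
      ∃ (p : ℕ) (_ : Fact p.Prime), V.selmerCorank p ≤ V.analyticRank := by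
    intro V _ _ h2
    obtain ⟨p₀, hp₀, h5, hgood, hord⟩ := WeierstrassCurve.exists_good_ordinary_prime_holds V
    by_cases hsurj : V.HasSurjectiveModNGaloisRep p₀
    · obtain ⟨hN, p, hp, h5', hgood', hord', hna, hsurj', hBr, a, b, hb, hab, hJ⟩ :=
        hE V h2 ⟨p₀, hp₀, h5, hgood, hord, hsurj⟩
      obtain ⟨J, C₁, hcap⟩ := hC V hN p h5' hgood' hord' hna hsurj' hBr a b hb hab
      obtain ⟨C₂, hm⟩ := hJ J
      have hp1 : (1 : ℝ) < (p : ℝ) := by exact_mod_cast hp.out.one_lt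
      have hp0 : (0 : ℝ) < (p : ℝ) := lt_trans zero_lt_one hp1
      have key : ∀ m : ℕ, V.selmerCorank p * (1 + m) ≤ V.analyticRank * (m + 1) + (C₁ + C₂) := by
        intro m
        obtain ⟨k, g, ι, s, hdiv, hkJ, hs, hnew, hordg, hcong, hall⟩ := hm m
        have hdiv' : (2 * b * (p - 1) : ℤ) ∣ (k - 2) := (Dvd.intro _ rfl).trans hdiv
        obtain ⟨j, hjodd, hj3, hjJ, hcapj⟩ := hcap k g ι s hdiv' hkJ hs hnew hordg hcong
        obtain ⟨hR, hlow⟩ := hall j hjodd hj3 hjJ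
        have hup := hcapj hR
        have hk0 : (k - 2) ≠ 0 := by omega
        have hpm : ((p : ℤ) ^ m) ∣ (k - 2) := (Dvd.intro_left _ rfl).trans hdiv
        have hmv : m ≤ padicValInt p (k - 2) := by
          rcases (padicValInt_dvd_iff m (k - 2)).mp hpm with h | h
          · exact absurd h hk0
          · exact h
        set x : ℝ := ‖ι ⟨_, hR⟩‖ with hx
        have hx0 : 0 ≤ x := norm_nonneg _
        set e₁ : ℕ := V.selmerCorank p * (1 + padicValInt p (k - 2)) with he₁
        set e₂ : ℕ := V.analyticRank * (m + 1) + C₂ with he₂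
        have hpow : (p : ℝ) ^ e₁ ≤ (p : ℝ) ^ (C₁ + e₂) := by
          calc (p : ℝ) ^ e₁ = (p : ℝ) ^ e₁ * 1 := by ring
            _ ≤ (p : ℝ) ^ e₁ * (x * (p : ℝ) ^ e₂) :=
                mul_le_mul_of_nonneg_left hlow (pow_nonneg hp0.le _)
            _ = (x * (p : ℝ) ^ e₁) * (p : ℝ) ^ e₂ := by ring
            _ ≤ (p : ℝ) ^ C₁ * (p : ℝ) ^ e₂ :=
                mul_le_mul_of_nonneg_right hup (pow_nonneg hp0.le _)
            _ = (p : ℝ) ^ (C₁ + e₂) := (pow_add (p : ℝ) C₁ e₂).symm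
        have hexp : e₁ ≤ C₁ + e₂ := (pow_le_pow_iff_right₀ hp1).mp hpow
        have hmono : V.selmerCorank p * (1 + m) ≤ e₁ :=
          Nat.mul_le_mul_left _ (by omega)
        omega
      have hUB : V.selmerCorank p ≤ V.analyticRank := by
        have hk := key (C₁ + C₂)
        by_contra hlt
        have hlt' : V.analyticRank < V.selmerCorank p := Nat.lt_of_not_le hlt
        have h1 : (V.analyticRank + 1) * (1 + (C₁ + C₂)) ≤ V.selmerCorank p * (1 + (C₁ + C₂)) :=
          Nat.mul_le_mul_right _ hlt'
        nlinarith
      exact ⟨p, hp, hUB⟩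
    · exact ⟨p₀, hp₀, (hSI V p₀ h5 hgood hord hsurj).le⟩
  -- rank = analytic rank on a global minimal model: points below, Selmer above — Ш never enters
  have hmin : ∀ (V : WeierstrassCurve ℚ) [V.IsElliptic] [V.IsGloballyMinimal],
      V.mordellWeilRank = V.analyticRank := by
    intro V _ _
    by_cases h1 : V.analyticRank ≤ 1
    · exact (hR1 V h1).1
    · obtain ⟨p, hp, hUB⟩ := hsel V (by omega)
      exact (lb_sha_bsd_of_points hP V p (by omega) hUB).2.2
  -- transport to an arbitrary Weierstrass model
  show ∀ W : WeierstrassCurve ℚ, W.IsElliptic → W.analyticRank = W.mordellWeilRank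
  intro W hW
  obtain ⟨C, hC⟩ := WeierstrassCurve.hasGlobalMinimalModel_rat_holds W
  have h5 := hmin (C • W)
  have h6 := hMW W C
  have h7 := hAn W C
  omega

end Summit.BirchSwinnertonDyer.BirchSwinnertonDyer.Cruxes.SelmerRankShaPFinite.Census
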